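import Literature.Computability.Complexity.DecisionTreeQueries
import Mathlib.Algebra.BigOperators.Field
import Mathlib.Analysis.SpecialFunctions.Pow.Real
import HarnessLib

/-!
# The O'Donnell–Saks–Schramm–Servedio inequality for `DecisionTree`, two-function form with query probabilities

Topic `Literature/Computability/Complexity` (companion of `DecisionTree.lean`, `DecisionTreeQueries.lean`, `KKLTheorem.lean`).
O'Donnell–Saks–Schramm–Servedio (FOCS 2005, Thm 3.2; O'Donnell, *Analysis of Boolean Functions* §8.6; inductive proof:
Lee 2010): for a deterministic decision tree `t` on `{0,1}^N` with `0/1` output `F` and ANY real `g` on the cube,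

  `Cov[F, g] ≤ ¼ Σⱼ δⱼ(t) · E_x |g(x^{j→1}) − g(x^{j→0})|`,   `δⱼ(t) = Pr_x[j ∈ t.queries x]`,

stated with un-normalised cube sums (`2^N Σ F·g − (Σ F)(Σ g) ≤ ¼ Σⱼ #{x : j ∈ t.queries x}·Mⱼ` whenever
`Σₓ |g(x^{j→1}) − g(x^{j→0})| ≤ Mⱼ`) for the Buhrman–de Wolf `DecisionTree` of this directory — ARBITRARY trees, possibly
re-querying a variable (a repeated query is answered consistently and charged once, as the `Finset` `DecisionTree.queries`
counts it; the tree's `…/ODonnellSaksSchrammServedio2005/DecisionTreeCovariance.lean` treats its own real-leaf `DTree` under a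
`Reduced` hypothesis instead).  Proof: Lee's induction relative to a PARTIAL ASSIGNMENT `ρ`; at a fresh root variable `i`,
`Cov[F,g] = ½Cov[F₀,Γ] + ½Cov[F₁,Γ] + ¼E[(F₁−F₀)(g₁−g₀)]` with `Γ = (g₀+g₁)/2`, and the weights split accordingly.

* `DecisionTree.osss_queries_aux` (inductive form rel. `ρ`), **`DecisionTree.osss_queries`** (the inequality).
The one-function form `Var[f] ≤ Σⱼ δⱼ Infⱼ[f]` (KKL vocabulary) is drawn in `DecisionTreeOSSSVariance.lean`.  First proved
for route SosSandwich of summit QuantumAdvantage (`Theorems/…ClassicalCornerQueryOSSSAux.lean`); this is its Literature home.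
References: O'Donnell–Saks–Schramm–Servedio, *Every decision tree has an influential variable*, FOCS 2005, Thm 3.2;
H. K. Lee, *Decision trees and influence: an inductive proof of the OSSS inequality*, ToC 6 (2010); O'Donnell 2014 §8.6.
-/

noncomputable section

namespace Literature.Computability.Complexity

open Finset Function

namespace DecisionTree

variable {N : ℕ}

/-! ### Cube sums branching on one coordinate -/

/-- A cube sum of a branch on `x i` between two functions not depending on `x i` is the average of their sums.
[folklore] -/
private theorem sum_ite_update (i : Fin N) (ψ₁ ψ₀ : (Fin N → Bool) → ℝ)
    (h₁ : ∀ x c, ψ₁ (update x i c) = ψ₁ x) (h₀ : ∀ x c, ψ₀ (update x i c) = ψ₀ x) :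
    ∑ x, (if x i = true then ψ₁ x else ψ₀ x) = ((∑ x, ψ₁ x) + ∑ x, ψ₀ x) / 2 := by
  let τ : (Fin N → Bool) → (Fin N → Bool) := fun x => update x i (!x i)
  have hτ : Function.Involutive τ := by
    intro x
    simp only [τ, update_self, update_idem, Bool.not_not, update_eq_self]
  have key : ∑ x, (if x i = true then ψ₁ x else ψ₀ x) = ∑ x, (if x i = true then ψ₀ x else ψ₁ x) := by
    rw [← Equiv.sum_comp (hτ.toPerm τ) (fun x => if x i = true then ψ₀ x else ψ₁ x)]
    refine Finset.sum_congr rfl fun x _ => ?_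
    simp only [Function.Involutive.coe_toPerm]
    rcases Bool.eq_false_or_eq_true (x i) with hx | hx
    · simp [τ, hx, h₁]
    · simp [τ, hx, h₀]
  have hsum : (∑ x, (if x i = true then ψ₁ x else ψ₀ x)) + ∑ x, (if x i = true then ψ₀ x else ψ₁ x)
      = (∑ x, ψ₁ x) + ∑ x, ψ₀ x := by
    rw [← Finset.sum_add_distrib, ← Finset.sum_add_distrib]
    exact Finset.sum_congr rfl fun x _ => by split_ifs <;> ring
  rw [← key] at hsum
  linarith

/-- `Σ_x h(x) = (Σ_x h(x^{i→1}) + Σ_x h(x^{i→0})) / 2`. [folklore] -/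
private theorem sum_eq_half_sum_update (i : Fin N) (h : (Fin N → Bool) → ℝ) :
    ∑ x, h x = ((∑ x, h (update x i true)) + ∑ x, h (update x i false)) / 2 := by
  have hre : ∑ x, h x = ∑ x, (if x i = true then h (update x i true) else h (update x i false)) := by
    refine Finset.sum_congr rfl fun x _ => ?_
    split_ifs with hx
    · rw [← hx, update_eq_self]
    · rw [Bool.not_eq_true] at hx
      rw [← hx, update_eq_self]
  rw [hre]
  exact sum_ite_update i _ _ (fun x c => by simp) (fun x c => by simp)

/-- The `L¹` increments of an average `(g₀ + g₁)/2` of the two `i`-sections of `g` are dominated by those of `g`: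
for `j ≠ i`, `Σ_x |Γ(x^{j→1}) − Γ(x^{j→0})| ≤ Σ_x |g(x^{j→1}) − g(x^{j→0})|` with
`Γ(x) = (g(x^{i→0}) + g(x^{i→1}))/2`; for `j = i` the left side vanishes. [folklore] -/
private theorem sum_abs_sections_le (i j : Fin N) (g : (Fin N → Bool) → ℝ) :
    ∑ x, |(g (update (update x j true) i false) + g (update (update x j true) i true)) / 2
        - (g (update (update x j false) i false) + g (update (update x j false) i true)) / 2|
      ≤ ∑ x, |g (update x j true) - g (update x j false)| := by
  by_cases hji : j = i
  · subst hji
    have h0 : ∀ x : Fin N → Bool,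
        |(g (update (update x j true) j false) + g (update (update x j true) j true)) / 2
          - (g (update (update x j false) j false) + g (update (update x j false) j true)) / 2| = 0 := by
      intro x; simp
    rw [Finset.sum_congr rfl fun x _ => h0 x, Finset.sum_const_zero]
    exact Finset.sum_nonneg fun x _ => abs_nonneg _
  -- `j ≠ i`: commute the updates and average the two `i`-sections
  have hcomm : ∀ (x : Fin N → Bool) (c b : Bool), update (update x j c) i b = update (update x i b) j c :=
    fun x c b => update_comm hji _ _ _
  set h : (Fin N → Bool) → ℝ := fun y => |g (update y j true) - g (update y j false)| with hh
  have hsplit := sum_eq_half_sum_update i h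
  have htri : ∀ x : Fin N → Bool,
      |(g (update (update x j true) i false) + g (update (update x j true) i true)) / 2
        - (g (update (update x j false) i false) + g (update (update x j false) i true)) / 2|
        ≤ (h (update x i true) + h (update x i false)) / 2 := by
    intro x
    simp only [hh, hcomm]
    have := abs_add_le (( g (update (update x i true) j true) - g (update (update x i true) j false)) / 2)
      ((g (update (update x i false) j true) - g (update (update x i false) j false)) / 2)
    rw [abs_div, abs_div, abs_two] at this
    calc _ = |(g (update (update x i true) j true) - g (update (update x i true) j false)) / 2
          + (g (update (update x i false) j true) - g (update (update x i false) j false)) / 2| := by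
            congr 1; ring
      _ ≤ _ := this
      _ = _ := by ring
  calc _ ≤ ∑ x, (h (update x i true) + h (update x i false)) / 2 := Finset.sum_le_sum fun x _ => htri x
    _ = ((∑ x, h (update x i true)) + ∑ x, h (update x i false)) / 2 := by
        rw [← Finset.sum_div, Finset.sum_add_distrib]
    _ = ∑ x, h x := hsplit.symm
    _ = _ := by simp only [hh]


/-- The cube `{0,1}^N` has `2^N` points. [folklore] -/
private theorem card_cube_nat : Fintype.card (Fin N → Bool) = 2 ^ N := by
  rw [Fintype.card_fun, Fintype.card_bool, Fintype.card_fin]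

/-! ### OSSS with query probabilities, inductive form -/

/-- **OSSS with query probabilities, inductive version (Lee's induction).** For a decision tree `T` run on the input
overridden by the partial assignment `ρ`, with `0/1` output `F`, and any `g` with `L¹` increments `≤ Mⱼ` in direction `j`:
`2^N Σ F·g − (Σ F)(Σ g) ≤ ¼ Σⱼ Wⱼ·Mⱼ`, `Wⱼ = #{x : ρ j = none ∧ j ∈ T.queries(x̃)}` (only coordinates not fixed by `ρ`
are charged, each once). [cite: OdonnellEtAl2005, Thm 3.2] [cite: Lee2010, Thm 1 (inductive proof)] -/
theorem osss_queries_aux (T : DecisionTree N) :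
    ∀ (ρ : Fin N → Option Bool) (F g : (Fin N → Bool) → ℝ) (M : Fin N → ℝ),
      (∀ x, F x = if T.eval (fun k => (ρ k).getD (x k)) = true then (1 : ℝ) else 0) → (∀ j, 0 ≤ M j) →
      (∀ j : Fin N, ∑ x, |g (update x j true) - g (update x j false)| ≤ M j) →
      (2 : ℝ) ^ N * (∑ x, F x * g x) - (∑ x, F x) * (∑ x, g x) ≤
        (∑ j, (∑ x : Fin N → Bool,
          (if ρ j = none ∧ j ∈ T.queries (fun k => (ρ k).getD (x k)) then (1 : ℝ) else 0)) * M j) / 4 := by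
  classical
  induction T with
  | leaf c =>
    intro ρ F g M hF hM hg
    have hc : ∀ x : Fin N → Bool, F x = (if c = true then (1 : ℝ) else 0) := fun x => by
      rw [hF x]; simp [DecisionTree.eval]
    have h1 : ∑ x, F x * g x = (if c = true then (1 : ℝ) else 0) * ∑ x, g x := by
      rw [Finset.mul_sum]; exact Finset.sum_congr rfl fun x _ => by rw [hc x]
    have h2 : ∑ x, F x = (2 : ℝ) ^ N * (if c = true then (1 : ℝ) else 0) := by
      rw [Finset.sum_congr rfl fun x _ => hc x, Finset.sum_const, Finset.card_univ, card_cube_nat,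
        nsmul_eq_mul]
      push_cast; ring
    rw [h1, h2]
    have hR : 0 ≤ (∑ j, (∑ x : Fin N → Bool,
        (if ρ j = none ∧ j ∈ (DecisionTree.leaf c : DecisionTree N).queries (fun k => (ρ k).getD (x k))
          then (1 : ℝ) else 0)) * M j) / 4 :=
      div_nonneg (Finset.sum_nonneg fun j _ => mul_nonneg
        (Finset.sum_nonneg fun x _ => by split_ifs <;> norm_num) (hM j)) (by norm_num)
    nlinarith [hR]
  | query i t₀ t₁ ih₀ ih₁ =>
    intro ρ F g M hF hM hg
    -- notation for the weights
    set W : Fin N → ℝ := fun j => ∑ x : Fin N → Bool,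
      (if ρ j = none ∧ j ∈ (DecisionTree.query i t₀ t₁).queries (fun k => (ρ k).getD (x k))
        then (1 : ℝ) else 0) with hW
    rcases hρ : ρ i with _ | b
    · /- fresh query: split along `x i` -/
      set ρ₀ : Fin N → Option Bool := update ρ i (some false) with hρ₀
      set ρ₁ : Fin N → Option Bool := update ρ i (some true) with hρ₁
      set F₀ : (Fin N → Bool) → ℝ :=
        fun x => if t₀.eval (fun k => (ρ₀ k).getD (x k)) = true then (1 : ℝ) else 0 with hF₀
      set F₁ : (Fin N → Bool) → ℝ :=
        fun x => if t₁.eval (fun k => (ρ₁ k).getD (x k)) = true then (1 : ℝ) else 0 with hF₁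
      set g₀ : (Fin N → Bool) → ℝ := fun x => g (update x i false) with hg₀
      set g₁ : (Fin N → Bool) → ℝ := fun x => g (update x i true) with hg₁
      set Γ : (Fin N → Bool) → ℝ := fun x => (g₀ x + g₁ x) / 2 with hΓ
      set W₀ : Fin N → ℝ := fun j => ∑ x : Fin N → Bool,
        (if ρ₀ j = none ∧ j ∈ t₀.queries (fun k => (ρ₀ k).getD (x k)) then (1 : ℝ) else 0) with hW₀
      set W₁ : Fin N → ℝ := fun j => ∑ x : Fin N → Bool,
        (if ρ₁ j = none ∧ j ∈ t₁.queries (fun k => (ρ₁ k).getD (x k)) then (1 : ℝ) else 0) with hW₁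
      -- overriding by `ρ[i ↦ b]` ignores `x i`
      have hov : ∀ (b c : Bool) (x : Fin N → Bool),
          (fun k => ((update ρ i (some b)) k).getD ((update x i c) k))
            = fun k => ((update ρ i (some b)) k).getD (x k) := by
        intro b c x; funext k
        by_cases hk : k = i
        · subst hk; simp
        · simp [hk]
      have hF₀u : ∀ x c, F₀ (update x i c) = F₀ x := fun x c => by simp only [hF₀, hρ₀, hov]
      have hF₁u : ∀ x c, F₁ (update x i c) = F₁ x := fun x c => by simp only [hF₁, hρ₁, hov]
      have hg₀u : ∀ x c, g₀ (update x i c) = g₀ x := fun x c => by simp [hg₀]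
      have hg₁u : ∀ x c, g₁ (update x i c) = g₁ x := fun x c => by simp [hg₁]
      -- on the branch `x i = b` the override by `ρ` is the override by `ρ[i ↦ b]`
      have hovb : ∀ (x : Fin N → Bool),
          (fun k => (ρ k).getD (x k)) = fun k => ((update ρ i (some (x i))) k).getD (x k) := by
        intro x; funext k
        by_cases hk : k = i
        · subst hk; simp [hρ]
        · simp [hk]
      have hxi : ∀ x : Fin N → Bool, (ρ i).getD (x i) = x i := fun x => by simp [hρ]
      have hFx : ∀ x : Fin N → Bool, F x = if x i = true then F₁ x else F₀ x := by
        intro x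
        rw [hF x, DecisionTree.eval_query]
        simp only [hxi x]
        rcases Bool.eq_false_or_eq_true (x i) with hx | hx
        · rw [if_pos hx, if_pos hx, hF₁, hρ₁]
          simp only
          rw [hovb x, hx]
        · have hx' : ¬ (x i = true) := by rw [hx]; decide
          rw [if_neg hx', if_neg hx', hF₀, hρ₀]
          simp only
          rw [hovb x, hx]
      have hgs : ∀ x : Fin N → Bool, g x = if x i = true then g₁ x else g₀ x := by
        intro x
        rcases Bool.eq_false_or_eq_true (x i) with hx | hx
        · rw [if_pos hx, hg₁]; simp only; rw [← hx, update_eq_self]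
        · have hx' : ¬ (x i = true) := by rw [hx]; decide
          rw [if_neg hx', hg₀]; simp only; rw [← hx, update_eq_self]
      -- the six sums
      have hSfg : ∑ x, F x * g x = ((∑ x, F₁ x * g₁ x) + ∑ x, F₀ x * g₀ x) / 2 := by
        have : ∀ x, F x * g x = if x i = true then F₁ x * g₁ x else F₀ x * g₀ x := by
          intro x; rw [hFx x]
          rcases Bool.eq_false_or_eq_true (x i) with hx | hx
          · rw [if_pos hx, if_pos hx, hgs x, if_pos hx]
          · have hx' : ¬ (x i = true) := by rw [hx]; decide
            rw [if_neg hx', if_neg hx', hgs x, if_neg hx']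
        rw [Finset.sum_congr rfl fun x _ => this x]
        exact sum_ite_update i _ _ (fun x c => by rw [hF₁u, hg₁u]) (fun x c => by rw [hF₀u, hg₀u])
      have hSf : ∑ x, F x = ((∑ x, F₁ x) + ∑ x, F₀ x) / 2 := by
        rw [Finset.sum_congr rfl fun x _ => hFx x]
        exact sum_ite_update i _ _ hF₁u hF₀u
      have hSg : ∑ x, g x = ((∑ x, g₁ x) + ∑ x, g₀ x) / 2 := by
        conv_lhs => rw [Finset.sum_congr rfl fun x (_ : x ∈ Finset.univ) => hgs x]
        exact sum_ite_update i _ _ hg₁u hg₀u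
      -- induction hypotheses on the sections, against `Γ`
      have hΓ_incr : ∀ j : Fin N, ∑ x, |Γ (update x j true) - Γ (update x j false)| ≤ M j := by
        intro j
        refine le_trans ?_ (hg j)
        simp only [hΓ, hg₀, hg₁]
        exact sum_abs_sections_le i j g
      have IH₀ := ih₀ ρ₀ F₀ Γ M (fun x => rfl) hM hΓ_incr
      have IH₁ := ih₁ ρ₁ F₁ Γ M (fun x => rfl) hM hΓ_incr
      have hΓ₀ : ∑ x, F₀ x * Γ x = ((∑ x, F₀ x * g₀ x) + ∑ x, F₀ x * g₁ x) / 2 := by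
        rw [← Finset.sum_add_distrib, Finset.sum_div]
        exact Finset.sum_congr rfl fun x _ => by simp only [hΓ]; ring
      have hΓ₁ : ∑ x, F₁ x * Γ x = ((∑ x, F₁ x * g₀ x) + ∑ x, F₁ x * g₁ x) / 2 := by
        rw [← Finset.sum_add_distrib, Finset.sum_div]
        exact Finset.sum_congr rfl fun x _ => by simp only [hΓ]; ring
      have hΓs : ∑ x, Γ x = ((∑ x, g₀ x) + ∑ x, g₁ x) / 2 := by
        rw [← Finset.sum_add_distrib, Finset.sum_div]
      rw [hΓ₀, hΓs] at IH₀
      rw [hΓ₁, hΓs] at IH₁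
      change (2 : ℝ) ^ N * (((∑ x, F₀ x * g₀ x) + ∑ x, F₀ x * g₁ x) / 2) -
          (∑ x, F₀ x) * (((∑ x, g₀ x) + ∑ x, g₁ x) / 2) ≤ (∑ j, W₀ j * M j) / 4 at IH₀
      change (2 : ℝ) ^ N * (((∑ x, F₁ x * g₀ x) + ∑ x, F₁ x * g₁ x) / 2) -
          (∑ x, F₁ x) * (((∑ x, g₀ x) + ∑ x, g₁ x) / 2) ≤ (∑ j, W₁ j * M j) / 4 at IH₁
      -- the cross term `Σ (F₁ − F₀)(g₁ − g₀) ≤ Σ |g₁ − g₀| ≤ M i`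
      have hF01 : ∀ x, |F₁ x - F₀ x| ≤ 1 := by
        intro x; simp only [hF₁, hF₀]; split_ifs <;> norm_num
      have hcross : (∑ x, F₁ x * g₁ x) - (∑ x, F₁ x * g₀ x) - (∑ x, F₀ x * g₁ x) + ∑ x, F₀ x * g₀ x ≤ M i := by
        have h1 : (∑ x, F₁ x * g₁ x) - (∑ x, F₁ x * g₀ x) - (∑ x, F₀ x * g₁ x) + ∑ x, F₀ x * g₀ x
            = ∑ x, (F₁ x - F₀ x) * (g₁ x - g₀ x) := by
          rw [← Finset.sum_sub_distrib, ← Finset.sum_sub_distrib, ← Finset.sum_add_distrib]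
          exact Finset.sum_congr rfl fun x _ => by ring
        rw [h1]
        calc ∑ x, (F₁ x - F₀ x) * (g₁ x - g₀ x) ≤ ∑ x, |g₁ x - g₀ x| := by
              refine Finset.sum_le_sum fun x _ => ?_
              calc (F₁ x - F₀ x) * (g₁ x - g₀ x) ≤ |(F₁ x - F₀ x) * (g₁ x - g₀ x)| := le_abs_self _
                _ = |F₁ x - F₀ x| * |g₁ x - g₀ x| := abs_mul _ _
                _ ≤ 1 * |g₁ x - g₀ x| := mul_le_mul_of_nonneg_right (hF01 x) (abs_nonneg _)
                _ = |g₁ x - g₀ x| := one_mul _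
          _ ≤ M i := by simpa only [hg₁, hg₀] using hg i
      -- the weights: `(W₀ j + W₁ j)/2 + [j = i]·2^N ≤ W j`
      have hWi : W i = (2 : ℝ) ^ N := by
        simp only [hW]
        have : ∀ x : Fin N → Bool, (if ρ i = none ∧ i ∈ (DecisionTree.query i t₀ t₁).queries
            (fun k => (ρ k).getD (x k)) then (1 : ℝ) else 0) = 1 := by
          intro x
          rw [if_pos ⟨hρ, by rw [DecisionTree.queries_query]; exact Finset.mem_insert_self _ _⟩]
        rw [Finset.sum_congr rfl fun x _ => this x, Finset.sum_const, Finset.card_univ, card_cube_nat,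
          nsmul_eq_mul, mul_one]
        push_cast; ring
      have hW₀i : W₀ i = 0 := by
        simp only [hW₀]
        refine Finset.sum_eq_zero fun x _ => ?_
        rw [if_neg]
        rintro ⟨h, -⟩
        rw [hρ₀, update_self] at h
        exact Option.some_ne_none _ h
      have hW₁i : W₁ i = 0 := by
        simp only [hW₁]
        refine Finset.sum_eq_zero fun x _ => ?_
        rw [if_neg]
        rintro ⟨h, -⟩
        rw [hρ₁, update_self] at h
        exact Option.some_ne_none _ h
      have hWj : ∀ j, j ≠ i → W j = (W₁ j + W₀ j) / 2 := by
        intro j hji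
        simp only [hW, hW₀, hW₁]
        -- rewrite the summand as a branch on `x i`
        have hρj₀ : ρ₀ j = ρ j := by rw [hρ₀, update_of_ne hji]
        have hρj₁ : ρ₁ j = ρ j := by rw [hρ₁, update_of_ne hji]
        have hpt : ∀ x : Fin N → Bool,
            (if ρ j = none ∧ j ∈ (DecisionTree.query i t₀ t₁).queries (fun k => (ρ k).getD (x k))
              then (1 : ℝ) else 0) =
            if x i = true then
              (if ρ₁ j = none ∧ j ∈ t₁.queries (fun k => (ρ₁ k).getD (x k)) then (1 : ℝ) else 0)
            else
              (if ρ₀ j = none ∧ j ∈ t₀.queries (fun k => (ρ₀ k).getD (x k)) then (1 : ℝ) else 0) := by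
          intro x
          have hq : (DecisionTree.query i t₀ t₁).queries (fun k => (ρ k).getD (x k)) =
              insert i (if x i = true then t₁.queries (fun k => (ρ k).getD (x k))
                else t₀.queries (fun k => (ρ k).getD (x k))) := by
            rw [DecisionTree.queries_query, hxi x]
          rcases Bool.eq_false_or_eq_true (x i) with hx | hx
          · have hov' := hovb x
            rw [hx, ← hρ₁] at hov'
            have hmem : (ρ j = none ∧ j ∈ (DecisionTree.query i t₀ t₁).queries (fun k => (ρ k).getD (x k))) ↔
                (ρ₁ j = none ∧ j ∈ t₁.queries (fun k => (ρ₁ k).getD (x k))) := by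
              rw [hq, hx, if_pos rfl, Finset.mem_insert, hρj₁, ← hov']
              simp only [hji, false_or]
            rw [if_pos hx]
            by_cases hc : (ρ₁ j = none ∧ j ∈ t₁.queries (fun k => (ρ₁ k).getD (x k)))
            · rw [if_pos hc, if_pos (hmem.mpr hc)]
            · rw [if_neg hc, if_neg (fun h => hc (hmem.mp h))]
          · have hx' : ¬ (x i = true) := by rw [hx]; decide
            have hov' := hovb x
            rw [hx, ← hρ₀] at hov'
            have hmem : (ρ j = none ∧ j ∈ (DecisionTree.query i t₀ t₁).queries (fun k => (ρ k).getD (x k))) ↔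
                (ρ₀ j = none ∧ j ∈ t₀.queries (fun k => (ρ₀ k).getD (x k))) := by
              rw [hq, hx, if_neg Bool.false_ne_true, Finset.mem_insert, hρj₀, ← hov']
              simp only [hji, false_or]
            rw [if_neg hx']
            by_cases hc : (ρ₀ j = none ∧ j ∈ t₀.queries (fun k => (ρ₀ k).getD (x k)))
            · rw [if_pos hc, if_pos (hmem.mpr hc)]
            · rw [if_neg hc, if_neg (fun h => hc (hmem.mp h))]
        rw [Finset.sum_congr rfl fun x _ => hpt x]
        refine sum_ite_update i _ _ (fun x c => ?_) (fun x c => ?_)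
        · simp only [hρ₁, hov]
        · simp only [hρ₀, hov]
      have hsum : (∑ j, W₀ j * M j) / 2 + (∑ j, W₁ j * M j) / 2 + (2 : ℝ) ^ N * M i ≤ ∑ j, W j * M j := by
        have hsplit : ∀ (V : Fin N → ℝ), ∑ j, V j * M j = V i * M i + ∑ j ∈ Finset.univ.erase i, V j * M j := by
          intro V
          rw [← Finset.add_sum_erase Finset.univ (fun j => V j * M j) (Finset.mem_univ i)]
        rw [hsplit W₀, hsplit W₁, hsplit W, hW₀i, hW₁i, hWi]
        have hrest : ∑ j ∈ Finset.univ.erase i, W j * M j =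
            (∑ j ∈ Finset.univ.erase i, W₀ j * M j) / 2 + (∑ j ∈ Finset.univ.erase i, W₁ j * M j) / 2 := by
          rw [Finset.sum_div, Finset.sum_div, ← Finset.sum_add_distrib]
          refine Finset.sum_congr rfl fun j hj => ?_
          rw [hWj j (Finset.ne_of_mem_erase hj)]
          ring
        rw [hrest]
        nlinarith
      rw [hSfg, hSf, hSg]
      have h2N : (0 : ℝ) ≤ (2 : ℝ) ^ N := by positivity
      nlinarith [IH₀, IH₁, hcross, hsum, mul_nonneg h2N (hM i)]
    · /- the root variable is already assigned by `ρ`: the tree behaves as the `b`-subtree, weights only grow -/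
      have hxi : ∀ x : Fin N → Bool, (ρ i).getD (x i) = b := fun x => by simp [hρ]
      have hmono : ∀ (t : DecisionTree N),
          (∀ x : Fin N → Bool, t.queries (fun k => (ρ k).getD (x k)) ⊆
            (DecisionTree.query i t₀ t₁).queries (fun k => (ρ k).getD (x k))) →
          (∑ j, (∑ x : Fin N → Bool,
            (if ρ j = none ∧ j ∈ t.queries (fun k => (ρ k).getD (x k)) then (1 : ℝ) else 0)) * M j) / 4 ≤
          (∑ j, W j * M j) / 4 := by
        intro t hsub
        refine div_le_div_of_nonneg_right (Finset.sum_le_sum fun j _ => ?_) (by norm_num)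
        refine mul_le_mul_of_nonneg_right (Finset.sum_le_sum fun x _ => ?_) (hM j)
        split_ifs with h1 h2
        · exact le_rfl
        · exact absurd ⟨h1.1, hsub x h1.2⟩ h2
        · norm_num
        · exact le_rfl
      cases b with
      | false =>
        have hF' : ∀ x, F x = if t₀.eval (fun k => (ρ k).getD (x k)) = true then (1 : ℝ) else 0 := by
          intro x; rw [hF x, DecisionTree.eval_query]; simp only [hxi x]; rfl
        refine (ih₀ ρ F g M hF' hM hg).trans (hmono t₀ fun x => ?_)
        rw [DecisionTree.queries_query, hxi x]
        exact Finset.subset_insert _ _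
      | true =>
        have hF' : ∀ x, F x = if t₁.eval (fun k => (ρ k).getD (x k)) = true then (1 : ℝ) else 0 := by
          intro x; rw [hF x, DecisionTree.eval_query]; simp only [hxi x]; rfl
        refine (ih₁ ρ F g M hF' hM hg).trans (hmono t₁ fun x => ?_)
        rw [DecisionTree.queries_query, hxi x]
        exact Finset.subset_insert _ _

/-- **The OSSS inequality with query probabilities, two-function form** (O'Donnell–Saks–Schramm–Servedio 2005, Thm 3.2;
O'Donnell 2014 §8.6), for the tree's `DecisionTree` (arbitrary, possibly re-querying trees): with `F` the `0/1` output of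
`t` and `Σₓ|g(x^{j→1}) − g(x^{j→0})| ≤ Mⱼ`,
`2^N Σ F·g − (Σ F)(Σ g) ≤ ¼ Σⱼ #{x : j ∈ t.queries x}·Mⱼ`, i.e. `Cov[F,g] ≤ ¼ Σⱼ δⱼ(t)·E|g(x^{j→1}) − g(x^{j→0})|`.
[cite: OdonnellEtAl2005, Thm 3.2] [cite: ODonnell2014, §8.6] -/
theorem osss_queries (t : DecisionTree N) (F g : (Fin N → Bool) → ℝ) (M : Fin N → ℝ)
    (hF : ∀ x, F x = if t.eval x = true then (1 : ℝ) else 0) (hM : ∀ j, 0 ≤ M j)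
    (hg : ∀ j : Fin N, ∑ x, |g (update x j true) - g (update x j false)| ≤ M j) :
    (2 : ℝ) ^ N * (∑ x, F x * g x) - (∑ x, F x) * (∑ x, g x) ≤
      (∑ j, ((Finset.univ.filter fun x : Fin N → Bool => j ∈ t.queries x).card : ℝ) * M j) / 4 := by
  classical
  have key := osss_queries_aux t (fun _ => none) F g M (fun x => by rw [hF x]; rfl) hM hg
  refine key.trans (le_of_eq ?_)
  congr 1
  refine Finset.sum_congr rfl fun j _ => ?_
  congr 1
  rw [← Finset.sum_boole]
  refine Finset.sum_congr rfl fun x _ => ?_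
  simp only [true_and]
  rfl

end DecisionTree

end Literature.Computability.Complexity

end
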